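import Summits.RiemannHypothesis.RiemannHypothesis.Theses.SmoothSectorHardy
import Summits.RiemannHypothesis.RiemannHypothesis.Theorems.ScrewLemmaKCoprofileDefs
import Summits.RiemannHypothesis.RiemannHypothesis.Theorems.ScrewLemmaKCoprofileSquareIntegrable
import Summits.RiemannHypothesis.RiemannHypothesis.Theorems.ScrewLemmaKCoprofileCoprofileMoments
import Summits.RiemannHypothesis.RiemannHypothesis.Theorems.ScrewLemmaKCoprofileCoprofileParseval
import Summits.RiemannHypothesis.RiemannHypothesis.Theorems.ScrewLemmaKCoprofileMomentGramFloor
import HarnessLib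

/-!
# Route `SmoothSectorHardy`, item `HardyThreePointBound` (K2, stmt-RiemannHypothesis-21566)

THREE-POINT BOUND for the weighted boundary energy of an admissible generator `g`:

  `2π⁵ · g(0)² ≤ ∫_ℝ ‖∫₀¹ g′(u) u^{−1/2+it} du‖² · ‖ζ(3/2+it)‖² dt`.

Proof (the co-profile road of route `ScrewLemmaKCoprofile`, all inputs in the tree): by the
co-profile Parseval identity (`ScrewLemmaKCoprofile.coprofileParseval`, item 22439) the right-hand
side equals `2π · ∫₀¹ Φ_g²` with `Φ_g(t) = Σ_{n ≤ 1/t} g′(nt)/n` the lattice co-profile; its three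
moments against `1, √t, t` are `(π²/3)·h₀, 0, 0` (`integral_latticeCoprofile{,_mul_sqrt,_mul_id}`,
item 21613, `h₀ = latticePlateau g = −g(0)/2`), and the Gram floor
(`momentGramFloor_proof`, item 21614: `36 (∫₀¹ Φ)² ≤ ∫₀¹ Φ²` under the two vanishing moments — the
`(0,0)` entry `36` of the inverse Cauchy matrix of `1, √t, t`) gives
`∫₀¹ Φ_g² ≥ 36 · (π² h₀/3)² = π⁴ g(0)²`, whence the bound `2π · π⁴ g(0)² = 2π⁵ g(0)²`.  This is the
Hardy-space three-point interpolation bound of the route thesis transported to `L²(0,1)` by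
Mellin–Plancherel (the interpolation nodes `0, 1/2, 1` become the monomials `1, √t, t`).  The
integrability proviso of the item is not needed (it holds anyway:
`ScrewLemmaKCoprofile.integrable_coprofileBoundaryEnergy`).  RH-free real analysis; RH is not
proved by this and nothing here bears on the truth of RH.

Main result: `hardyThreePointBound_proof : …Theses.SmoothSectorHardy.HardyThreePointBound` (the
route decl by name); helper `coprofile_sq_integral_ge`.
-/

set_option linter.dupNamespace false

noncomputable section

namespace Summit.RiemannHypothesis.RiemannHypothesis.Theorems.SmoothSectorHardy

open MeasureTheory Set
open Summit.RiemannHypothesis.RiemannHypothesis.Theorems.IntegerScrew (SmoothSectorAdmissible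
  latticePlateau)
open Summit.RiemannHypothesis.RiemannHypothesis.Theorems.ScrewLemmaKCoprofile

/-- CO-PROFILE ENERGY FLOOR: for admissible `g`, `π⁴ · g(0)² ≤ ∫₀¹ Φ_g(t)² dt`
(Gram floor `36 (∫Φ)² ≤ ∫Φ²` at the moments `∫Φ_g = (π²/3)h₀`, `∫Φ_g√t = ∫Φ_g·t = 0`,
`h₀ = −g(0)/2`). [folklore] -/
theorem coprofile_sq_integral_ge {g : ℝ → ℝ} (hg : SmoothSectorAdmissible g) :
    Real.pi ^ 4 * (g 0) ^ 2 ≤ ∫ t in Set.Ioo (0:ℝ) 1, (latticeCoprofile g t) ^ 2 := by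
  have hΦ : MemLp (latticeCoprofile g) 2 (volume.restrict (Set.Ioo (0:ℝ) 1)) :=
    memLp_two_latticeCoprofile hg.1
  have h1 : (∫ t in Set.Ioo (0:ℝ) 1, latticeCoprofile g t * Real.sqrt t) = 0 :=
    integral_latticeCoprofile_mul_sqrt hg
  have h2 : (∫ t in Set.Ioo (0:ℝ) 1, latticeCoprofile g t * t) = 0 :=
    integral_latticeCoprofile_mul_id hg
  have key := momentGramFloor_proof (latticeCoprofile g) hΦ h1 h2
  rw [integral_latticeCoprofile hg] at key
  unfold latticePlateau at key
  have e : 36 * (Real.pi ^ 2 / 3 * (-g 0 / 2)) ^ 2 = Real.pi ^ 4 * (g 0) ^ 2 := by ring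
  rw [e] at key
  exact key

/-- Arithmetic glue: `b ≤ (2a)⁻¹·X` with `a > 0` gives `2a·b ≤ X`. [folklore] -/
theorem two_pi_mul_le_of_le_inv_mul {a b X : ℝ} (ha : 0 < a) (h : b ≤ (1 / (2 * a)) * X) :
    2 * a * b ≤ X := by
  have h' : 2 * a * b ≤ 2 * a * ((1 / (2 * a)) * X) :=
    mul_le_mul_of_nonneg_left h (by positivity)
  have e : 2 * a * ((1 / (2 * a)) * X) = X := by
    field_simp
  rw [e] at h'
  exact h'

/-- **Item `HardyThreePointBound` (K2, stmt-RiemannHypothesis-21566)**, the route decl by name: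
for every admissible `g` (with integrable weighted boundary energy),
`2π⁵ g(0)² ≤ ∫_ℝ ‖∫₀¹ g′(u)u^{−1/2+it} du‖² ‖ζ(3/2+it)‖² dt` — co-profile Parseval plus the
co-profile energy floor. RH-free. [folklore] -/
theorem hardyThreePointBound_proof :
    Summit.RiemannHypothesis.RiemannHypothesis.Theses.SmoothSectorHardy.HardyThreePointBound := by
  unfold Summit.RiemannHypothesis.RiemannHypothesis.Theses.SmoothSectorHardy.HardyThreePointBound
  intro g hg _
  have hP := coprofileParseval g hg
  have e : (fun t : ℝ => (∑ n ∈ Finset.Icc 1 ⌊1 / t⌋₊, deriv g (n * t) / n) ^ 2)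
      = fun t => (latticeCoprofile g t) ^ 2 := rfl
  rw [e] at hP
  have hfloor := coprofile_sq_integral_ge hg
  rw [hP] at hfloor
  have h2 := two_pi_mul_le_of_le_inv_mul Real.pi_pos hfloor
  exact (by ring : (2:ℝ) * Real.pi ^ 5 * (g 0) ^ 2
    = 2 * Real.pi * (Real.pi ^ 4 * (g 0) ^ 2)).trans_le h2

end Summit.RiemannHypothesis.RiemannHypothesis.Theorems.SmoothSectorHardy

end
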